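import Literature.NumberTheory.DiophantineGeometry.GenEllThm21With
import Literature.NumberTheory.DiophantineGeometry.GenEllPhiMechanismPlaces
import HarnessLib

/-!
# Exponent rigidity of the noncritical-Belyi transfer of [GenEll] Thm 2.1 (ii) ⇒ (i): the degree
# threshold, the instance table, and the one-coefficient bookkeeping (negative memo)

S. Mochizuki, *Arithmetic elliptic curves in general position*, Math. J. Okayama Univ. **52** (2010),
Theorem 2.1, proof pp. 12–13 [cite: MochizukiGenEll2010, Thm 2.1 proof pp.12–13].

WHAT THIS FILE IS ABOUT: the printed MECHANISM of (ii) ⇒ (i) (equivalently the tree's transcription of it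
for `ℙ¹ ∖ {0,1,∞}`, `GenEllPhiMechanism.vojtaIneq_of_belyi_mechanism` and its places twin), and what it
yields when statement (ii) is available only with a height coefficient `Λ > 1`
(`GenEllThm21With.ABCCompactlyBoundedWith S Λ`, R-H round-2 exponent programme of the abc-iut cell,
EXP-SPEC F2, ruling R19 "exponent rigidity").  It is NOT a claim that «(ii)_Λ ⇒ (i)_Λ» is false for
`Λ > 1`: that implication is simply not in print and not in reach of the printed transfer; it stays the
predicate `GenEll_thm21_primesWith Λ`, asserted by nobody.  Open.

THE TWO LOSSES OF THE PRINTED PROOF (p. 12–13), read with a coefficient.  Print proves (ii) ⇒ (i) at the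
coefficient `1 + ε`, `ε > 0` arbitrary, consuming (ii) at an auxiliary `ε′` that it takes SMALL:
(α) the cover `Y → X` ramified over `D` with index `e` (p. 12: "by choosing `e` to be sufficiently large,
we may assume that `deg(ω_X(D)|_Y) = deg(ω_Y(E)) ≤ (1+ε′)·deg(ω_Y)`", Prop. 1.7 (ii)) — for `X = ℙ¹`,
`deg D = 3`, this is the margin `A − B_c = (e−3)/e` of `slope_sub_eq`; it is absorbed for ANY coefficient
by taking `e` large; (β) the EXTRA DIVISOR `E := φ⁻¹(C)_red` of the noncritical Belyi map `φ` chosen for a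
limit configuration (p. 13: "`≲ (1+ε′)(log-diff_X + ht_E) − ht_E ≈ (1+ε′)·log-diff_X + ε′·ht_E
≈ (1+ε′)·log-diff_X + ε′·(deg(E)/deg(ω_X))·ht_{ω_X}`"), absorbed by the choice on p. 12, last display:
"`1 + ε′ ≤ (1+ε)·(1 − ε′·deg(E)/deg(ω_X))`" — which exists ONLY because `ε′ → 0` is allowed: `deg E =
deg φ − (2g−2)` (Riemann–Hurwitz) is unbounded over the configurations of the compactness step.  With
(ii) at coefficient `1 + η = Λ(1+ε′)`, `Λ > 1`, the p. 13 chain reads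
`ht_{ω_X}·(1 − η·deg(E)/deg(ω_X)) ≲ (1+η)·log-diff_X` with `η ≥ Λ − 1 > 0`: no conclusion at any
configuration whose Belyi map has `deg(E)/deg(ω_X) ≥ 1/(Λ−1)`.  In the tree's binders: the transfer
needs `hslope : 0 < A − (1+ε′)·B_c` with `A − B_c = (e−3)/e` and
`B_c = ((deg β + 2)(e+3) − 3e − 3)/e = (deg β − 1) + 3(deg β + 1)/e` (`slope_sub_eq`; in
`mechanismFor_places`: `e = 2k+1`, `e + 3 = 2k+4`, `3e + 3 = 6k+6`), the source is consumed AT `ε′`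
(`vojtaIneq_farFromCusps_of_subset … hε'`), and `exists_eps_of_margin` picks `ε′ ≤ (A − B_c)/(2(B_c+1))`.
`GenEllThm21With.belyi_slope_not_pos` records the failure of `hslope` once `(Λ−1)·B_c ≥ A − B_c`; this file
adds the closed form of `B_c`, the DEGREE THRESHOLD `deg β ≥ 1 + 1/(Λ−1)` (all `e`), the instance table
of the programme (`Λ ∈ {1.30, 1.91, 2.37, 8}`), and — the positive fragment — the exact output
coefficient `(1+η)/(A − (1+η)·B_c)` of the bookkeeping when (ii) is demanded at ONE coefficient.

* `belyi_Bc_eq`, `belyi_Bc_nonneg`, `one_le_belyi_Bc` — `B_c = (deg β − 1) + 3(deg β + 1)/e`, `≥ 0`,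
  `≥ 1` for `deg β ≥ 2`;
* `belyi_rigidity_of_deg` — `(Λ−1)(deg β − 1) ≥ 1 ⟹ (e−3)/e ≤ (Λ−1)·B_c` for every `e > 0`;
* `belyi_slope_not_pos_of_deg`, `belyi_slope_not_pos_places_of_deg` — hence `¬ 0 < A − (1+ε′)·B_c` for
  every source `ε′ ≥ Λ − 1`, in the binders of `vojtaIneq_of_belyi_mechanism` (`e`) and of
  `mechanismFor_places` (`k`);
* the instance table as `example`s;
* `vojtaIneq_of_belyi_mechanism_at`, `vojtaIneq_of_belyi_mechanism_with` — the p. 13 bookkeeping with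
  (ii) at ONE degree and ONE coefficient `1+η` (resp. (ii)_Λ at one `ε′`), output coefficient
  `(1+η)/(A − (1+η)·B_c)` under `hslope`, nothing absorbed.

Theorems only (no definitions, no named facts); elementary real arithmetic plus the record bookkeeping;
[GenEll] is classical and refereed — the statements here concern carrying a coefficient through its
PROOF only; nothing bears on [IUTchIII] Cor. 3.12 and nothing asserts abc (with or without exponent).
-/

noncomputable section

open NumberField

namespace Literature.NumberTheory.DiophantineGeometry.GenEll

/-! ## §1 The extra-divisor coefficient `B_c` and the degree threshold -/

/-- **`B_c` in closed form**: `((deg β + 2)(e+3) − 3e − 3)/e = (deg β − 1) + 3(deg β + 1)/e` — the height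
coefficient of the extra divisor of the Belyi map `β` of degree `deg β` on the cover `D_e`
(`slope_sub_eq`: `A − B_c = (e−3)/e`). [cite: MochizukiGenEll2010, Thm 2.1 proof p.13] -/
theorem belyi_Bc_eq (n e : ℝ) (he : e ≠ 0) :
    ((n + 2) * (e + 3) - 3 * e - 3) / e = (n - 1) + 3 * (n + 1) / e := by
  field_simp
  ring

/-- `B_c ≥ 0` for `deg β ≥ 1`, `e > 0` (the hypothesis `hBc` of `exists_eps_of_margin` /
`belyi_slope_not_pos`). [cite: MochizukiGenEll2010, Thm 2.1 proof p.13] -/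
theorem belyi_Bc_nonneg {n e : ℝ} (hn : 1 ≤ n) (he : 0 < e) :
    0 ≤ ((n + 2) * (e + 3) - 3 * e - 3) / e := by
  rw [belyi_Bc_eq n e he.ne']
  have : 0 ≤ 3 * (n + 1) / e := div_nonneg (by linarith) he.le
  linarith

/-- `B_c ≥ 1 > (e−3)/e` as soon as `deg β ≥ 2`: the extra-divisor coefficient already exceeds the whole
margin of loss (α), so at `Λ ≥ 2` NO source `ε′ ≥ Λ − 1` is admissible at any Belyi degree `≥ 2`.
[cite: MochizukiGenEll2010, Thm 2.1 proof p.13] -/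
theorem one_le_belyi_Bc {n e : ℝ} (hn : 2 ≤ n) (he : 0 < e) :
    1 ≤ ((n + 2) * (e + 3) - 3 * e - 3) / e := by
  rw [belyi_Bc_eq n e he.ne']
  have : 0 ≤ 3 * (n + 1) / e := div_nonneg (by linarith) he.le
  linarith

/-- **THE DEGREE THRESHOLD.** If `(Λ − 1)·(deg β − 1) ≥ 1` with `Λ ≥ 1` — i.e. `deg β ≥ 1 + 1/(Λ−1)` — then
`(e−3)/e ≤ (Λ−1)·B_c` for EVERY `e > 0`: the rigidity hypothesis `hrig` of `belyi_slope_not_pos` with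
`A − B_c = (e−3)/e`. (Indeed `(Λ−1)·B_c ≥ (Λ−1)(deg β − 1) ≥ 1 > 1 − 3/e`.) [cite: MochizukiGenEll2010, Thm 2.1 proof p.13] -/
theorem belyi_rigidity_of_deg {n e Λ : ℝ} (he : 0 < e) (hΛ : 1 ≤ Λ) (hdeg : 1 ≤ (Λ - 1) * (n - 1)) :
    (e - 3) / e ≤ (Λ - 1) * (((n + 2) * (e + 3) - 3 * e - 3) / e) := by
  rw [belyi_Bc_eq n e he.ne']
  have hΛ1 : 0 ≤ Λ - 1 := by linarith
  have hn1 : 0 ≤ n - 1 := by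
    by_contra hneg
    have : (Λ - 1) * (n - 1) ≤ 0 := mul_nonpos_of_nonneg_of_nonpos hΛ1 (le_of_lt (not_le.mp hneg))
    linarith
  have h3 : 0 ≤ (Λ - 1) * (3 * (n + 1) / e) :=
    mul_nonneg hΛ1 (div_nonneg (by linarith) he.le)
  have hlhs : (e - 3) / e ≤ 1 := by
    rw [div_le_one he]; linarith
  nlinarith

/-- **No admissible source above the threshold** (binders of `vojtaIneq_of_belyi_mechanism`,
`A = deg β·(e+3)/e`, `B_c = ((deg β + 2)(e+3) − 3e − 3)/e`): if `deg β ≥ 1 + 1/(Λ−1)` then for every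
`e > 0` and every source coefficient `ε′ ≥ Λ − 1` the slope condition `0 < A − (1+ε′)·B_c` FAILS.
(`belyi_slope_not_pos` ∘ `belyi_rigidity_of_deg` ∘ `slope_sub_eq`.) [cite: MochizukiGenEll2010, Thm 2.1 proof p.13] -/
theorem belyi_slope_not_pos_of_deg {n e ε' Λ : ℝ} (he : 0 < e) (hn : 1 ≤ n) (hΛ : 1 ≤ Λ)
    (hdeg : 1 ≤ (Λ - 1) * (n - 1)) (hε' : Λ - 1 ≤ ε') :
    ¬ 0 < n * (e + 3) / e - (1 + ε') * (((n + 2) * (e + 3) - 3 * e - 3) / e) := by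
  refine belyi_slope_not_pos (belyi_Bc_nonneg hn he) hε' ?_
  rw [slope_sub_eq n e he.ne']
  exact belyi_rigidity_of_deg he hΛ hdeg

/-- **The same in the binders of `mechanismFor_places` / `vojtaIneq_mechanism_of_condBound_places`**
(`e = 2k+1`: `A = deg φ·(2k+4)/(2k+1)`, `B_c = ((deg φ + 2)(2k+4) − (6k+6))/(2k+1)`): for
`deg φ ≥ 1 + 1/(Λ−1)` and every `k`, no source `ε′ ≥ Λ − 1` satisfies `hslope`.
[cite: MochizukiGenEll2010, Thm 2.1 proof p.13] -/
theorem belyi_slope_not_pos_places_of_deg {n : ℕ} (k : ℕ) {ε' Λ : ℝ} (hn : 1 ≤ n) (hΛ : 1 ≤ Λ)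
    (hdeg : 1 ≤ (Λ - 1) * ((n : ℝ) - 1)) (hε' : Λ - 1 ≤ ε') :
    ¬ 0 < (n : ℝ) * (2 * k + 4) / (2 * k + 1) -
        (1 + ε') * ((((n : ℝ) + 2) * (2 * k + 4) - (6 * k + 6)) / (2 * k + 1)) := by
  have he : (0 : ℝ) < 2 * k + 1 := by positivity
  have h := belyi_slope_not_pos_of_deg (n := (n : ℝ)) (e := 2 * k + 1) he (by exact_mod_cast hn) hΛ
    hdeg hε'
  have hA : (n : ℝ) * (2 * k + 4) / (2 * k + 1) -
        (1 + ε') * ((((n : ℝ) + 2) * (2 * k + 4) - (6 * k + 6)) / (2 * k + 1)) =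
      (n : ℝ) * (2 * k + 1 + 3) / (2 * k + 1) -
        (1 + ε') * ((((n : ℝ) + 2) * (2 * k + 1 + 3) - 3 * (2 * k + 1) - 3) / (2 * k + 1)) := by
    ring
  rw [hA]
  exact h

/-- **Where a coefficient does pass** (for the record): if `(1+ε′ − 1)·B_c < A − B_c`, i.e.
`ε′·B_c < (e−3)/e` (`belyi_slope_pos_iff`), the slope is positive and the bookkeeping applies with output
coefficient `(1+ε′)/(A − (1+ε′)·B_c)` (§3); at `deg β = 1` (`B_c = 6/e`) this admits every
`ε′ < (e−3)/6`, but the Belyi maps of the transfer have `deg β ≥ 2` in general and unbounded degree.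
[cite: MochizukiGenEll2010, Thm 2.1 proof p.13] -/
theorem belyi_slope_pos_of_lt {n e ε' : ℝ} (he : 0 < e)
    (h : ε' * (((n + 2) * (e + 3) - 3 * e - 3) / e) < (e - 3) / e) :
    0 < n * (e + 3) / e - (1 + ε') * (((n + 2) * (e + 3) - 3 * e - 3) / e) := by
  rw [belyi_slope_pos_iff, slope_sub_eq n e he.ne']
  exact h

/-! ## §2 The instance table of the exponent programme (EXP-SPEC v0.2 §7, MIN-SLICE v1.7)

Coefficients of record: `Λ = 8` (label cut `κ = 1/2`), `Λ = 2.37` (`κ = 3/4`), `Λ = 1.91` (the `μ₄` median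
of the 137-datum bed), `Λ = 1.30` (the financed-cliff mass).  "Fails" = the degree threshold holds, so no
source `ε′ ≥ Λ − 1` is admissible at any `e` (`belyi_slope_not_pos_of_deg`); "survives" = the slope at the
sharpest source `1 + ε′ = Λ` is positive for `e` large, with the stated output coefficient
`Λ/(A − Λ·B_c)`. -/

/-- `Λ = 8`: every Belyi degree `≥ 2` is above the threshold (`7·(n−1) ≥ 1`). [cite: MochizukiGenEll2010, Thm 2.1 proof p.13] -/
example (n : ℝ) (hn : 2 ≤ n) : 1 ≤ (8 - 1) * (n - 1) := by nlinarith

/-- `Λ = 2.37`: every Belyi degree `≥ 2` is above the threshold (`1.37·(n−1) ≥ 1`). [cite: MochizukiGenEll2010, Thm 2.1 proof p.13] -/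
example (n : ℝ) (hn : 2 ≤ n) : 1 ≤ (2.37 - 1) * (n - 1) := by nlinarith

/-- `Λ = 1.91`: every Belyi degree `≥ 3` is above the threshold (`0.91·(n−1) ≥ 1`). [cite: MochizukiGenEll2010, Thm 2.1 proof p.13] -/
example (n : ℝ) (hn : 3 ≤ n) : 1 ≤ (1.91 - 1) * (n - 1) := by nlinarith

/-- `Λ = 1.91`, `deg β = 2` (`A = 2(e+3)/e`, `B_c = 1 + 9/e`): at the sharpest source `1 + ε′ = 1.91` the
slope `A − 1.91·B_c = (0.09·e − 11.19)/e` is NOT positive for `e ≤ 124` … [cite: MochizukiGenEll2010, Thm 2.1 proof p.13] -/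
example (e : ℝ) (he : 0 < e) (he' : e ≤ 124) :
    ¬ 0 < 2 * (e + 3) / e - 1.91 * (((2 + 2) * (e + 3) - 3 * e - 3) / e) := by
  have h : 2 * (e + 3) / e - 1.91 * (((2 + 2) * (e + 3) - 3 * e - 3) / e) =
      (0.09 * e - 11.19) / e := by
    field_simp; ring
  rw [h, not_lt]
  exact div_nonpos_of_nonpos_of_nonneg (by linarith) he.le

/-- … and positive for `e ≥ 125`, with output coefficient `1.91/(A − 1.91·B_c) > 21` (`→ 1.91/0.09 ≈ 21.2`):
«`deg β = 2` survives only for `e ≥ 125`, with output `≥ 21×`». [cite: MochizukiGenEll2010, Thm 2.1 proof p.13] -/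
example (e : ℝ) (he : 125 ≤ e) :
    0 < 2 * (e + 3) / e - 1.91 * (((2 + 2) * (e + 3) - 3 * e - 3) / e) ∧
      21 < 1.91 / (2 * (e + 3) / e - 1.91 * (((2 + 2) * (e + 3) - 3 * e - 3) / e)) := by
  have he0 : 0 < e := by linarith
  have h : 2 * (e + 3) / e - 1.91 * (((2 + 2) * (e + 3) - 3 * e - 3) / e) =
      (0.09 * e - 11.19) / e := by
    field_simp; ring
  have hnum : 0 < 0.09 * e - 11.19 := by linarith
  have hpos : 0 < (0.09 * e - 11.19) / e := div_pos hnum he0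
  rw [h]
  refine ⟨hpos, ?_⟩
  rw [lt_div_iff₀ hpos, mul_div_assoc', div_lt_iff₀ he0]
  nlinarith

/-- `Λ = 1.30`: every Belyi degree `≥ 5` is above the threshold (`0.3·(n−1) ≥ 1`). [cite: MochizukiGenEll2010, Thm 2.1 proof p.13] -/
example (n : ℝ) (hn : 5 ≤ n) : 1 ≤ (1.30 - 1) * (n - 1) := by nlinarith

/-- `Λ = 1.30`, `deg β = 4` (`B_c = 3 + 15/e`): the slope at `1 + ε′ = 1.3` is `(0.1·e − 7.5)/e`, positive iff
`e > 75`; the output coefficient `1.3·e/(0.1·e − 7.5)` exceeds `13` — the degree survives only with a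
further loss factor `> 10`. [cite: MochizukiGenEll2010, Thm 2.1 proof p.13] -/
example (e : ℝ) (he : 75 < e) :
    0 < 4 * (e + 3) / e - 1.30 * (((4 + 2) * (e + 3) - 3 * e - 3) / e) ∧
      13 < 1.30 / (4 * (e + 3) / e - 1.30 * (((4 + 2) * (e + 3) - 3 * e - 3) / e)) := by
  have he0 : 0 < e := by linarith
  have h : 4 * (e + 3) / e - 1.30 * (((4 + 2) * (e + 3) - 3 * e - 3) / e) =
      (0.1 * e - 7.5) / e := by
    field_simp; ring
  have hnum : 0 < 0.1 * e - 7.5 := by linarith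
  have hpos : 0 < (0.1 * e - 7.5) / e := div_pos hnum he0
  rw [h]
  refine ⟨hpos, ?_⟩
  rw [lt_div_iff₀ hpos, mul_div_assoc', div_lt_iff₀ he0]
  nlinarith

/-- `Λ = 1.30`, `deg β = 2` (`B_c = 1 + 9/e`): the slope at `1 + ε′ = 1.3` is `(0.7·e − 5.7)/e`, positive iff
`e > 57/7` (`e ≥ 9`), output coefficient `1.3·e/(0.7·e − 5.7) > 13/7 ≈ 1.86`. [cite: MochizukiGenEll2010, Thm 2.1 proof p.13] -/
example (e : ℝ) (he : 9 ≤ e) :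
    0 < 2 * (e + 3) / e - 1.30 * (((2 + 2) * (e + 3) - 3 * e - 3) / e) ∧
      13 / 7 < 1.30 / (2 * (e + 3) / e - 1.30 * (((2 + 2) * (e + 3) - 3 * e - 3) / e)) := by
  have he0 : 0 < e := by linarith
  have h : 2 * (e + 3) / e - 1.30 * (((2 + 2) * (e + 3) - 3 * e - 3) / e) =
      (0.7 * e - 5.7) / e := by
    field_simp; ring
  have hnum : 0 < 0.7 * e - 5.7 := by linarith
  have hpos : 0 < (0.7 * e - 5.7) / e := div_pos hnum he0
  rw [h]
  refine ⟨hpos, ?_⟩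
  rw [lt_div_iff₀ hpos, mul_div_assoc', div_lt_iff₀ he0]
  nlinarith

/-! ## §3 The positive fragment: the bookkeeping of p. 13 with (ii) at ONE coefficient -/

/-- **The bookkeeping of [GenEll] p. 13 at one degree and one coefficient** (same data and proof as
`vojtaIneq_of_belyi_mechanism_of_subset`, statement (ii) demanded ONLY on the annulus `{FarFromCusps S ρ′}`
in degree `≤ d′` at the single coefficient `1 + η ≥ 0`).  If `0 < A − (1+η)·B_c`, Vojta's inequality holds
on `T` in degree `≤ d` with coefficient EXACTLY `(1+η)/(A − (1+η)·B_c)` — print's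
"`≲ (1+ε′)(log-diff_X + ht_E) − ht_E`" with `1+ε′ ↦ 1+η` and nothing absorbed: the honest yield of a
coefficient through ONE mechanism. [cite: MochizukiGenEll2010, Thm 2.1 proof p.13] -/
theorem vojtaIneq_of_belyi_mechanism_at {S : Finset ℕ} {T : Set NFPoint} {d d' : ℕ}
    {η ρ' : ℝ} (hη : 0 ≤ 1 + η)
    (hii : VojtaIneq {P : NFPoint | P.FarFromCusps S ρ'} d' η)
    (Z Q : NFPoint → NFPoint) (κ : NFPoint → ℝ) {A Bc c₁ c₂ c₃ : ℝ}
    (hZmem : ∀ P ∈ T ∩ UPle d, Z P ∈ UPle d')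
    (hZfar : ∀ P ∈ T ∩ UPle d, (Z P).FarFromCusps S ρ')
    (hZht : ∀ P ∈ T ∩ UPle d, A * P.ht ≤ (Z P).ht + c₁)
    (hZcond : ∀ P ∈ T ∩ UPle d, (Z P).logDiff + (Z P).logCond ≤ (Q P).logDiff + κ P)
    (hκ : ∀ P ∈ T ∩ UPle d, κ P ≤ Bc * P.ht + c₂)
    (hQ : ∀ P ∈ T ∩ UPle d, (Q P).logDiff ≤ P.logDiff + P.logCond + c₃)
    (hslope : 0 < A - (1 + η) * Bc) :
    VojtaIneq T d ((1 + η) / (A - (1 + η) * Bc) - 1) := by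
  obtain ⟨C, hC⟩ := hii
  have key : BDLe (T ∩ UPle d) (fun P => (1 - (1 - (A - (1 + η) * Bc))) * P.ht)
      (fun P => (1 + η) * (P.logDiff + P.logCond)) := by
    refine ⟨C + c₁ + (1 + η) * (c₂ + c₃), fun P hP => ?_⟩
    have hZ : Z P ∈ {P : NFPoint | P.FarFromCusps S ρ'} ∩ UPle d' := ⟨hZfar P hP, hZmem P hP⟩
    have h1 : (Z P).ht - (1 + η) * ((Z P).logDiff + (Z P).logCond) ≤ C := hC _ hZ
    have h2' := hZht P hP
    have h3 := hZcond P hP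
    have h4 := hκ P hP
    have h5 := hQ P hP
    have h6 : (1 + η) * ((Z P).logDiff + (Z P).logCond) ≤
        (1 + η) * (P.logDiff + P.logCond + c₃ + Bc * P.ht + c₂) := by
      refine mul_le_mul_of_nonneg_left ?_ hη
      linarith
    simp only
    nlinarith
  exact vojtaIneq_of_scaled (δ := 1 - (A - (1 + η) * Bc)) (by linarith) (by simp) key

/-- **The bookkeeping under (ii)_Λ at one source `ε′`** (`ABCCompactlyBoundedWith S₀ Λ`, `S₀ ⊆ S`,
`Λ > 0`, `ε′ > 0`): output coefficient EXACTLY `Λ(1+ε′)/(A − Λ(1+ε′)·B_c)` under the slope condition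
`0 < A − Λ(1+ε′)·B_c` — which §1 shows unsatisfiable at every Belyi degree `≥ 1 + 1/(Λ−1)`.  At `Λ = 1`
and `ε′` from `exists_eps_of_margin` this is the record transfer. [cite: MochizukiGenEll2010, Thm 2.1 proof p.13] -/
theorem vojtaIneq_of_belyi_mechanism_with {S₀ S : Finset ℕ} (hS : ∀ p ∈ S, p.Prime) (hsub : S₀ ⊆ S)
    {Λ : ℝ} (hΛ : 0 < Λ) (hii : ABCCompactlyBoundedWith S₀ Λ)
    {T : Set NFPoint} {d d' : ℕ} (hd' : 0 < d') {ε' ρ' : ℝ} (hε' : 0 < ε')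
    (hρ'0 : 0 < ρ') (hρ'2 : ρ' ≤ 1 / 2)
    (Z Q : NFPoint → NFPoint) (κ : NFPoint → ℝ) {A Bc c₁ c₂ c₃ : ℝ}
    (hZmem : ∀ P ∈ T ∩ UPle d, Z P ∈ UPle d')
    (hZfar : ∀ P ∈ T ∩ UPle d, (Z P).FarFromCusps S ρ')
    (hZht : ∀ P ∈ T ∩ UPle d, A * P.ht ≤ (Z P).ht + c₁)
    (hZcond : ∀ P ∈ T ∩ UPle d, (Z P).logDiff + (Z P).logCond ≤ (Q P).logDiff + κ P)
    (hκ : ∀ P ∈ T ∩ UPle d, κ P ≤ Bc * P.ht + c₂)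
    (hQ : ∀ P ∈ T ∩ UPle d, (Q P).logDiff ≤ P.logDiff + P.logCond + c₃)
    (hslope : 0 < A - Λ * (1 + ε') * Bc) :
    VojtaIneq T d (Λ * (1 + ε') / (A - Λ * (1 + ε') * Bc) - 1) := by
  -- (ii)_Λ on the annulus with support `{∞} ∪ S` at the single `(d′, ε′)`: coefficient `Λ(1+ε′)`
  have hfar : VojtaIneq {P : NFPoint | P.FarFromCusps S ρ'} d' (Λ * (1 + ε') - 1) :=
    vojtaIneqWith_farFromCusps_of_abcCompactlyBoundedWith hS
      (abcCompactlyBoundedWith_of_subset hsub hii) hd' hε' hρ'0 hρ'2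
  have hη : (0 : ℝ) ≤ 1 + (Λ * (1 + ε') - 1) := by nlinarith
  have h := vojtaIneq_of_belyi_mechanism_at hη hfar Z Q κ hZmem hZfar hZht hZcond hκ hQ
    (by convert hslope using 2; ring)
  convert h using 2; ring

end Literature.NumberTheory.DiophantineGeometry.GenEll

end
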